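import Summits.QuantumAdvantage.QuantumAdvantage.Theses.WildDial
import Summits.QuantumAdvantage.QuantumAdvantage.Theorems.RingPeriodFoldStrategies
import Summits.QuantumAdvantage.AdviceFreeQNC0.RingHardOdd
import HarnessLib

/-!
# The TOWER COLLAPSE of the covariant door `WildDial.CovHard3` (supports stmt-QuantumAdvantage-33109)

Cell decomp-qadv, seat lens-5 («finite range + asymptotic regime + bridge»), generation 18 — tree twin of §3/§3b/§5 of the
generation-17 node `IndexDial` (critic row 74v7: VERIFIED, law files endorsed).  NO NEW `Prop`: the node's `CovCellAt b` /
`CovHardAt b` / `Cell16` / `RingHardOddOn` are spelled out as hypotheses / conjuncts.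

`WildDial.CovHard3 : ∀ D, ∃ n₀, ∀ n ≥ n₀, n ∈ RingPeriodFold.covLosing D` (item 33109: for every degree `D`, on all large rings
no rotation-covariant `𝔽₃` rule of degree `≤ D` is perfect on the odd class).  On a GEOMETRIC TOWER of lengths `8b·3^j`
(`b ≥ 1`; the node's case is `b = 2`, lengths `16·3^j`) all cofactors `3^i` are ODD, so lens 2's fold amplifier
`RingPeriodFold.covNotPerfectAt_mul` (`d ∈ covLosing D`, `m` odd, `d ≥ 3` ⟹ `m·d ∈ covLosing D`) pushes one losing tower
length to every higher one (`tower_fold`).  Consequences, all proved here: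

* `covHard_tower_iff_cell` ★ — the door RESTRICTED TO A TOWER, `∀ D, ∃ n₀, ∀ n ≥ n₀, n ∈ tower → n ∈ covLosing D`, is
  EQUIVALENT to ONE FINITE CELL PER DEGREE, `∀ D, ∃ j, 8b·3^j ∈ covLosing D` (each cell a decidable finite statement);
  `covCell_tower_of_covHard3` — the cells follow from 33109 by name (WEAKER).  Contrast the all-`n` normal form
  `Theorems.covHard3_iff_certificates` (LeaderDialLengthDichotomy: powers of two + the fold-free core `2^a·p` remain as two
  infinite families); on a tower neither infinite family is consumed.
* `cell16_tower` — ONE certificate `16 ∈ covLosing 2` settles covariant-QUADRATIC non-exactness on the whole tower `16·3^j`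
  (census instrument K-g17: the XOR-aware decision of the cell `(D, n) = (2, 16)`); `foot_tower` is the parametric form.
* NECESSITY `covCell_tower_of_oddHard_tower` ★ / `covHard3_of_ringHardOdd`: odd-class ring hardness (the `RingHardOdd 3` shape)
  along the tower — resp. at all lengths — forces the cells — resp. the door 33109 — via `covLosing_of_oddHardAt` (a perfect
  covariant degree-`D` rule is a polylog-degree strategy solving the whole odd class once `log₂ n ≥ D`) and
  `card_odd_class_ge` (the odd class has `≥ 2^(n−1)` patterns).  So along a tower, ring hardness splits EXACTLY as
  «cells ∧ (cells → hardness)».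
-/

set_option linter.dupNamespace false

noncomputable section

open scoped Classical

namespace Summit.QuantumAdvantage.QuantumAdvantage.Theorems.IndexDial

open Finset
open Literature.Computability.QuantumComplexity Literature.Computability.MetaComplexity
open Literature.Computability.MetaComplexity.Smolensky
open Summit.QuantumAdvantage.AdviceFreeQNC0
open Summit.QuantumAdvantage.QuantumAdvantage.Theses
open Summit.QuantumAdvantage.QuantumAdvantage.Theorems.RingPeriodFold

/-! ## §1 Folding up a tower -/

/-- FOLD UP THE TOWER: all cofactors `3^i` are odd, so one losing tower length `8b·3^j` (`b ≥ 1`) makes every higher tower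
length `8b·3^(j+i)` losing (`RingPeriodFold.covNotPerfectAt_mul`). -/
theorem tower_fold {b D j : ℕ} (hb : 1 ≤ b) (h : 8 * b * 3 ^ j ∈ covLosing D) (i : ℕ) :
    8 * b * 3 ^ (j + i) ∈ covLosing D := by
  have hm : Odd (3 ^ i) := Odd.pow (by decide)
  have hd : 3 ≤ 8 * b * 3 ^ j := by
    have h3 : 1 ≤ 3 ^ j := Nat.one_le_pow j 3 (by norm_num)
    calc 3 ≤ 8 * b * 1 := by omega
      _ ≤ 8 * b * 3 ^ j := Nat.mul_le_mul_left _ h3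
  have h' := covNotPerfectAt_mul (m := 3 ^ i) (d := 8 * b * 3 ^ j) hm hd h
  have e : 3 ^ i * (8 * b * 3 ^ j) = 8 * b * 3 ^ (j + i) := by ring
  rwa [e] at h'

/-- the FOOT of a tower: a certificate at `8b` (`j = 0`) settles the whole tower `8b·3^j` at that degree. -/
theorem foot_tower {b D : ℕ} (hb : 1 ≤ b) (h : 8 * b ∈ covLosing D) (j : ℕ) : 8 * b * 3 ^ j ∈ covLosing D := by
  have h0 : 8 * b * 3 ^ 0 ∈ covLosing D := by simpa using h
  have := tower_fold hb h0 j
  simpa using this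

/-- «eventually along the tower» = «once on the tower». -/
theorem tower_eventually_iff {b : ℕ} (hb : 1 ≤ b) (D : ℕ) :
    (∃ j₀ : ℕ, ∀ j ≥ j₀, 8 * b * 3 ^ j ∈ covLosing D) ↔ ∃ j : ℕ, 8 * b * 3 ^ j ∈ covLosing D := by
  constructor
  · rintro ⟨j₀, h⟩
    exact ⟨j₀, h j₀ le_rfl⟩
  · rintro ⟨j, h⟩
    refine ⟨j, fun j' hj' => ?_⟩
    obtain ⟨i, rfl⟩ := Nat.exists_eq_add_of_le hj'
    exact tower_fold hb h i

/-- tower lengths are strictly increasing in the exponent: `8b·3^j ≥ 8b·3^{j₀}` forces `j ≥ j₀` (`b ≥ 1`). -/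
theorem le_of_towerLen_le {b j j₀ : ℕ} (hb : 1 ≤ b) (h : 8 * b * 3 ^ j₀ ≤ 8 * b * 3 ^ j) : j₀ ≤ j := by
  by_contra hcon
  have hlt : 3 ^ j < 3 ^ j₀ := Nat.pow_lt_pow_right (by norm_num) (by omega)
  have : 8 * b * 3 ^ j < 8 * b * 3 ^ j₀ := Nat.mul_lt_mul_of_pos_left hlt (by omega)
  omega

/-! ## §2 The finite-range collapse of the door on a tower -/

/-- ★ **THE FINITE-RANGE COLLAPSE**: WildDial's door restricted to the tower of base `b ≥ 1` («for every degree `D`, every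
large tower length `8b·3^j` is a losing length») is EQUIVALENT to ONE FINITE CELL PER DEGREE («for every `D`, SOME tower
length is a losing length»). -/
theorem covHard_tower_iff_cell {b : ℕ} (hb : 1 ≤ b) :
    (∀ D : ℕ, ∃ n₀ : ℕ, ∀ n ≥ n₀, (∃ j : ℕ, n = 8 * b * 3 ^ j) → n ∈ covLosing D) ↔
      ∀ D : ℕ, ∃ j : ℕ, 8 * b * 3 ^ j ∈ covLosing D := by
  constructor
  · intro h D
    obtain ⟨n₀, hn₀⟩ := h D
    have hlt : n₀ < 3 ^ n₀ := Nat.lt_pow_self (by norm_num)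
    have hle : 3 ^ n₀ ≤ 8 * b * 3 ^ n₀ := Nat.le_mul_of_pos_left _ (by omega)
    exact ⟨n₀, hn₀ _ (by omega) ⟨n₀, rfl⟩⟩
  · intro h D
    obtain ⟨j, hj⟩ := h D
    refine ⟨8 * b * 3 ^ j, fun n hn hnT => ?_⟩
    obtain ⟨j', rfl⟩ := hnT
    obtain ⟨i, rfl⟩ := Nat.exists_eq_add_of_le (le_of_towerLen_le hb hn)
    exact tower_fold hb hj i

/-- the tower cells are WEAKER than WildDial's door `CovHard3` (stmt-QuantumAdvantage-33109), BY NAME (restriction). -/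
theorem covCell_tower_of_covHard3 {b : ℕ} (hb : 1 ≤ b) (h : WildDial.CovHard3) :
    ∀ D : ℕ, ∃ j : ℕ, 8 * b * 3 ^ j ∈ covLosing D :=
  (covHard_tower_iff_cell hb).mp fun D => (h D).imp fun _ hn₀ n hn _ => hn₀ n hn

/-- conversely, the door restricted to the tower follows from the cells (the other direction of the collapse, spelled out). -/
theorem covHard_tower_of_cells {b : ℕ} (hb : 1 ≤ b) (h : ∀ D : ℕ, ∃ j : ℕ, 8 * b * 3 ^ j ∈ covLosing D) :
    ∀ D : ℕ, ∃ n₀ : ℕ, ∀ n ≥ n₀, (∃ j : ℕ, n = 8 * b * 3 ^ j) → n ∈ covLosing D :=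
  (covHard_tower_iff_cell hb).mpr h

/-! ## §3 The case `b = 2`: lengths `16·3^j`, foot `n = 16` -/

/-- ★ ONE CERTIFICATE AT `n = 16` (the census cell `(D, n) = (2, 16)`, instrument K-g17) settles covariant-QUADRATIC
non-exactness on the WHOLE tower `16·3^j`. -/
theorem cell16_tower (h : 16 ∈ covLosing 2) (j : ℕ) : 16 * 3 ^ j ∈ covLosing 2 := by
  have := foot_tower (b := 2) (D := 2) (by norm_num) (by simpa using h) j
  simpa using this

/-- … and hence the tower cells for every degree `D ≤ 2` (`covLosing` is antitone in the degree through `lowDeg_mono`). -/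
theorem cells_le_two_of_cell16 (h : 16 ∈ covLosing 2) : ∀ D ≤ 2, ∃ j : ℕ, 8 * 2 * 3 ^ j ∈ covLosing D := by
  intro D hD
  refine ⟨0, ?_⟩
  have h16 : (16 : ℕ) ∈ covLosing D := by
    rw [mem_covLosing] at h ⊢
    intro Q hQ
    exact h Q (lowDeg_mono hD hQ)
  simpa using h16

/-! ## §4 Necessity: ring hardness along the tower forces the cells -/

/-- at least half of all patterns lie in the odd class (complement of the tree's `card_even_class_le`). -/
theorem card_odd_class_ge (N : ℕ) (hN : 1 ≤ N) :
    2 ^ (N - 1) ≤ (univ.filter fun x : Fin N → Bool => OddZeros x).card := by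
  obtain ⟨m, rfl⟩ : ∃ m, N = m + 1 := ⟨N - 1, by omega⟩
  rw [Nat.add_sub_cancel]
  have hU : (univ : Finset (Fin (m + 1) → Bool)).card = 2 ^ (m + 1) := by simp
  have htot := Finset.card_filter_add_card_filter_not
    (s := (univ : Finset (Fin (m + 1) → Bool))) (fun x : Fin (m + 1) → Bool => OddZeros x)
  have heven : (univ.filter fun x : Fin (m + 1) → Bool => ¬ OddZeros x).card ≤ 2 ^ m := by
    refine le_trans (Finset.card_le_card ?_) card_even_class_le
    intro x hx
    rw [mem_filter] at hx ⊢
    exact ⟨mem_univ _, hx.2⟩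
  have h2 : 2 ^ (m + 1) = 2 * 2 ^ m := by ring
  omega

/-- ONE LENGTH: odd-class hardness with threshold `θ < 1` at polylog degree `(log₂ N)^c ≥ D` makes `N` a losing length for
covariant degree-`≤ D` rules — a perfect covariant rule `Q` is the polylog-degree strategy `covStrat Q` solving the whole odd
class, which has `≥ 2^(N−1) > θ·2^(N−1)` patterns. -/
theorem covLosing_of_oddHardAt {θ : ℝ} (hθ : θ < 1) {N D c : ℕ} (hN : 1 ≤ N) (hD : D ≤ (Nat.log 2 N) ^ c)
    (hhard : ∀ P : Fin N → CubeFn (ZMod 3) N,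
      (∀ i, P i ∈ lowDeg (ZMod 3) N ((Nat.log 2 N) ^ c)) →
      ((univ.filter fun x : Fin N → Bool =>
          OddZeros x ∧ RingHLF.Rel x (fun i => decide (P i x = 1))).card : ℝ) ≤ θ * (2 : ℝ) ^ (N - 1)) :
    N ∈ covLosing D := by
  rw [mem_covLosing]
  intro Q hQ
  by_contra hall
  have hall' : ∀ x : Fin N → Bool, OddZeros x → RingHLF.Rel x (cov Q x) := by
    intro x hx
    by_contra hR
    exact hall ⟨x, hx, hR⟩
  have hP : ∀ i, covStrat Q i ∈ lowDeg (ZMod 3) N ((Nat.log 2 N) ^ c) :=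
    fun i => lowDeg_mono hD (covStrat_mem_lowDeg hQ i)
  have hbound := hhard (covStrat Q) hP
  have hsub : (univ.filter fun x : Fin N → Bool => OddZeros x) ⊆
      univ.filter fun x : Fin N → Bool =>
        OddZeros x ∧ RingHLF.Rel x (fun i => decide (covStrat Q i x = 1)) := by
    intro x hx
    rw [mem_filter] at hx ⊢
    exact ⟨hx.1, hx.2, hall' x hx.2⟩
  have hge : (2 : ℝ) ^ (N - 1) ≤ ((univ.filter fun x : Fin N → Bool =>
      OddZeros x ∧ RingHLF.Rel x (fun i => decide (covStrat Q i x = 1))).card : ℝ) := by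
    have h1 := card_odd_class_ge N hN
    have h2 := Finset.card_le_card hsub
    exact_mod_cast h1.trans h2
  have hpos : (0 : ℝ) < (2 : ℝ) ^ (N - 1) := by positivity
  nlinarith [mul_pos (sub_pos.mpr hθ) hpos]

/-- ★ NECESSITY ON A TOWER: odd-class ring hardness along the tower `8·(b·3^j)` (the `RingHardOdd 3` shape, asked for all large
`j` only; `b ≥ 1`) forces every tower cell — take `c = 1` and the tower length at exponent `j₀ + D`, whose `log₂` exceeds `D`. -/
theorem covCell_tower_of_oddHard_tower {b : ℕ} (hb : 1 ≤ b)
    (h : ∃ θ : ℝ, θ < 1 ∧ ∀ c : ℕ, ∃ j₀ : ℕ, ∀ j ≥ j₀,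
      ∀ P : Fin (8 * (b * 3 ^ j)) → CubeFn (ZMod 3) (8 * (b * 3 ^ j)),
        (∀ i, P i ∈ lowDeg (ZMod 3) (8 * (b * 3 ^ j)) ((Nat.log 2 (8 * (b * 3 ^ j))) ^ c)) →
        ((univ.filter fun x : Fin (8 * (b * 3 ^ j)) → Bool =>
            OddZeros x ∧ RingHLF.Rel x (fun i => decide (P i x = 1))).card : ℝ) ≤ θ * (2 : ℝ) ^ (8 * (b * 3 ^ j) - 1)) :
    ∀ D : ℕ, ∃ j : ℕ, 8 * b * 3 ^ j ∈ covLosing D := by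
  obtain ⟨θ, hθ, hh⟩ := h
  intro D
  obtain ⟨j₀, hj₀⟩ := hh 1
  refine ⟨j₀ + D, ?_⟩
  have hjn : j₀ + D < 3 ^ (j₀ + D) := Nat.lt_pow_self (by norm_num)
  have hle : 3 ^ (j₀ + D) ≤ 8 * (b * 3 ^ (j₀ + D)) := by nlinarith [Nat.one_le_pow (j₀ + D) 3 (by norm_num)]
  have h1n : 1 ≤ 8 * (b * 3 ^ (j₀ + D)) := by omega
  have hDlog : D ≤ (Nat.log 2 (8 * (b * 3 ^ (j₀ + D)))) ^ 1 := by
    have h2 : 2 ^ D ≤ 8 * (b * 3 ^ (j₀ + D)) :=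
      calc 2 ^ D ≤ 2 ^ (j₀ + D) := Nat.pow_le_pow_right (by norm_num) (by omega)
        _ ≤ 3 ^ (j₀ + D) := Nat.pow_le_pow_left (by norm_num) _
        _ ≤ 8 * (b * 3 ^ (j₀ + D)) := hle
    rw [pow_one]
    exact Nat.le_log_of_pow_le one_lt_two h2
  have hmem := covLosing_of_oddHardAt hθ h1n hDlog (hj₀ (j₀ + D) (by omega))
  have e : 8 * (b * 3 ^ (j₀ + D)) = 8 * b * 3 ^ (j₀ + D) := by ring
  rwa [e] at hmem

/-- NECESSITY AT ALL LENGTHS: the cell's crux `RingHardOdd 3` gives WildDial's door `CovHard3` (33109) — the landed form of the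
junction `covHard3_of_T` recorded in the item's docstring (there via `NoPerfectConst3`; here directly from odd-class hardness). -/
theorem covHard3_of_ringHardOdd (h : RingHardOdd 3) : WildDial.CovHard3 := by
  obtain ⟨θ, hθ, hh⟩ := h
  intro D
  obtain ⟨n₀, hn₀⟩ := hh 1
  refine ⟨max n₀ (2 ^ D), fun n hn => ?_⟩
  have hn₀n : n₀ ≤ n := le_trans (le_max_left _ _) hn
  have h2D : 2 ^ D ≤ n := le_trans (le_max_right _ _) hn
  have h1n : 1 ≤ n := le_trans (Nat.one_le_two_pow) h2D
  have hDlog : D ≤ (Nat.log 2 n) ^ 1 := by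
    rw [pow_one]
    exact Nat.le_log_of_pow_le one_lt_two h2D
  exact covLosing_of_oddHardAt hθ h1n hDlog (hn₀ n hn₀n)

/-- the cells of every tower follow from `RingHardOdd 3` (composition; also = `covCell_tower_of_covHard3 ∘ covHard3_of_ringHardOdd`). -/
theorem covCell_tower_of_ringHardOdd {b : ℕ} (hb : 1 ≤ b) (h : RingHardOdd 3) :
    ∀ D : ℕ, ∃ j : ℕ, 8 * b * 3 ^ j ∈ covLosing D :=
  covCell_tower_of_covHard3 hb (covHard3_of_ringHardOdd h)

/-- ★ THE EXACT SPLIT along a tower (`b ≥ 1`): odd-class ring hardness along the tower ⟺ (the tower cells) ∧ (cells ⟹ hardness) —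
the second conjunct is the honest residual, the first the finite range; necessity is `covCell_tower_of_oddHard_tower`. -/
theorem oddHard_tower_iff_cells_and_lift {b : ℕ} (hb : 1 ≤ b) :
    (∃ θ : ℝ, θ < 1 ∧ ∀ c : ℕ, ∃ j₀ : ℕ, ∀ j ≥ j₀,
      ∀ P : Fin (8 * (b * 3 ^ j)) → CubeFn (ZMod 3) (8 * (b * 3 ^ j)),
        (∀ i, P i ∈ lowDeg (ZMod 3) (8 * (b * 3 ^ j)) ((Nat.log 2 (8 * (b * 3 ^ j))) ^ c)) →
        ((univ.filter fun x : Fin (8 * (b * 3 ^ j)) → Bool =>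
            OddZeros x ∧ RingHLF.Rel x (fun i => decide (P i x = 1))).card : ℝ) ≤ θ * (2 : ℝ) ^ (8 * (b * 3 ^ j) - 1)) ↔
    ((∀ D : ℕ, ∃ j : ℕ, 8 * b * 3 ^ j ∈ covLosing D) ∧
      ((∀ D : ℕ, ∃ j : ℕ, 8 * b * 3 ^ j ∈ covLosing D) →
        ∃ θ : ℝ, θ < 1 ∧ ∀ c : ℕ, ∃ j₀ : ℕ, ∀ j ≥ j₀,
          ∀ P : Fin (8 * (b * 3 ^ j)) → CubeFn (ZMod 3) (8 * (b * 3 ^ j)),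
            (∀ i, P i ∈ lowDeg (ZMod 3) (8 * (b * 3 ^ j)) ((Nat.log 2 (8 * (b * 3 ^ j))) ^ c)) →
            ((univ.filter fun x : Fin (8 * (b * 3 ^ j)) → Bool =>
                OddZeros x ∧ RingHLF.Rel x (fun i => decide (P i x = 1))).card : ℝ) ≤ θ * (2 : ℝ) ^ (8 * (b * 3 ^ j) - 1))) :=
  ⟨fun h => ⟨covCell_tower_of_oddHard_tower hb h, fun _ => h⟩, fun h => h.2 h.1⟩

end Summit.QuantumAdvantage.QuantumAdvantage.Theorems.IndexDial
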